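import Mathlib
import Literature.Computability.AlgebraicComplexity.FermionicPencil
import Literature.Computability.AlgebraicComplexity.FermionantCompletenessProofs
import HarnessLib

/-!
# ValiantsHypothesis / FermionicJet — `HcProjectsToCdet`, part 1: the averaging graph at the free-fermion point

Helper file for item `stmt-ValiantsHypothesis-5342` (`HcProjectsToCdet`, route `FermionicJet`: `HC_n` is a
p-projection of the cycle-counting determinant `cdet_n = ∑_σ sgn σ · c(σ) · ∏ᵢ X_{σ i, i}`). The closing
file `FermionicJetHcProjectsToCdet.lean` imports this one.

## Content

Write `cycW β M = ∑_σ β^{c(σ)} ∏ᵢ M i (σ i)` (`Literature…DeRugyAltherre.cycW`) for the cycle-weighted cover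
sum; the fermionic pencil is `Ferm^λ(M) = (-1)^N cycW (-λ) M` and the cycle jets (in particular
`cdet = f_{·,1}`) are the Taylor coefficients of `cycW (-(1+X))` over `R[X]`
(`aeval_cdetPoly_eq_coeff_cycW`, the `j = 1` case of `Theorems.FermionicJetJetChain.aeval_cycleJetPoly_eq_coeff_cycW`,
re-proved here so that this helper stays outside the import cone of the route file).

* `cycW_allOnes_fin` — **the cycle generating polynomial of `S_m`**: `∑_{γ ∈ S_m} β^{c(γ)} = ∏_{i<m} (β+i)`
  (ascending Pochhammer symbol / Stirling numbers of the first kind), from the vertex elimination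
  identity `cycW_att1` and the row expansion `sum_mul_cycW_updateRow`: a new vertex is a loop (`β`) or is
  inserted into one of the `m` arcs of a cover of the rest.
* `avgConst_eq_prod` — the averaging constant of de Rugy-Altherre's Stage B graph
  (`DeRugyAltherre.avgConst`, left symbolic in the Literature file, which only needed its positivity) IS
  that polynomial: the covers of the base averaging graph are the "return permutations"
  `inl i ↦ inr i, inr j ↦ inl (γ j)`, which have `c(γ)` cycles (`numCycles_retPerm`, by the two orbit
  comparison maps of `DeRugyAltherre.numOrbits_le_of_map`).
* `MB_map` — the averaging matrices commute with ring homomorphisms (passage to `R[X]`).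
* `coeff_one_avgPoly` — **the first Taylor coefficient at the free-fermion point**: with `β = -(1+X)`,
  `[X¹] (β^n)^{n+1} ∏_{i ≤ n} (β + i) = (n-1)!` for `n ≥ 1` (and `-1` for `n = 0`): the falling factorial
  `λ(λ-1)⋯(λ-n)` has a SIMPLE zero at `λ = 1` — this is where the sign is broken by the cycle count
  (`det` of the averaging graph vanishes, `cdet` does not).
* `aeval_MB_cdetPoly` — **the reduction identity**: substituting the averaging graph of any
  `(n+1) × (n+1)` matrix `Z` into `cdet_N`, `N = 2(n+1) + (n+1)²`, gives `(-1)^N · q_n · per Z` with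
  `q_n = (n-1)!` (`-1` for `n = 0`), by `DeRugyAltherre.cycW_MB`.

Sub-namespace `…Theorems.FermionicJetHcProjectsToCdet`; no route (`Theses`) file is imported. (Audit `orphan`
flags on `sum_mul_cycW_updateRow` / `cycW_allOnes_option`: artefacts of the recursion in `cycW_allOnes_fin`.)
-/

noncomputable section

set_option linter.dupNamespace false -- single-conjunct summit: `ValiantsHypothesis.ValiantsHypothesis`

open Equiv Equiv.Perm Finset Polynomial
open Literature.Computability.AlgebraicComplexity
open Literature.Computability.AlgebraicComplexity.DeRugyAltherre

namespace Summit.ValiantsHypothesis.ValiantsHypothesis.Theorems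

namespace FermionicJetHcProjectsToCdet

/-! ### `cdet` as a coefficient of the cycle-weighted cover sum over `R[X]` -/

section Jets

variable {K : Type*} [Field K]

/-- The cycle formula for the sign, first-jet form: `sgn τ · c(τ) = (-1)^N (-1)^{c(τ)} c(τ)` for
`τ ∈ S_N` (the `j = 1` case of `FermionicJetJetChain.sign_mul_choose_eq`). [folklore] -/
theorem sign_mul_numCycles_eq {N : ℕ} (τ : Perm (Fin N)) :
    ((((Equiv.Perm.sign τ : ℤ) * ((τ.numCycles : ℕ) : ℤ)) : ℤ) : K) =
      (-1) ^ N * ((-1) ^ τ.numCycles * (τ.numCycles : K)) := by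
  have h := Equiv.Perm.sign_mul_neg_one_pow_numCycles τ
  rw [Fintype.card_fin] at h
  have h3 : (Equiv.Perm.sign τ : ℤ) = (-1) ^ N * (-1) ^ τ.numCycles := by
    calc (Equiv.Perm.sign τ : ℤ)
        = (Equiv.Perm.sign τ : ℤ) * ((-1) ^ τ.numCycles * (-1) ^ τ.numCycles) := by
          rw [← pow_add, ← two_mul, pow_mul, neg_one_sq, one_pow, mul_one]
      _ = ((Equiv.Perm.sign τ : ℤ) * (-1) ^ τ.numCycles) * (-1) ^ τ.numCycles := by ring
      _ = (-1) ^ N * (-1) ^ τ.numCycles := by rw [h]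
  have h4 : ((Equiv.Perm.sign τ : ℤ) : K) = ((-1 : K) ^ N) * ((-1 : K) ^ τ.numCycles) := by
    have := congrArg (Int.cast : ℤ → K) h3
    push_cast at this
    exact this
  push_cast
  rw [h4]
  ring

/-- **`cdet` is the `X¹`-coefficient of the cycle-weighted cover sum at `β = -(1+X)`.** Substituting the
entries of a matrix `M` (reindexed to `Fin N`) into `cdet_N` gives `(-1)^N [X¹] cycW (-(1+X)) M` over
`R[X]`: `∑_σ sgn σ c(σ) M^σ = (-1)^N [X¹] ∑_σ (-1)^{c(σ)} (1+X)^{c(σ)} M^σ` (the `j = 1` case of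
`FermionicJetJetChain.aeval_cycleJetPoly_eq_coeff_cycW`, re-proved to stay outside the route file's
import cone). [folklore] -/
theorem aeval_cdetPoly_eq_coeff_cycW {ι : Type*} {W : Type*} [Fintype W] [DecidableEq W] {N : ℕ}
    (e : W ≃ Fin N) (M : Matrix W W (MvPolynomial ι K)) :
    MvPolynomial.aeval (fun pq : Fin N × Fin N => M (e.symm pq.1) (e.symm pq.2)) (cdetPoly (Fin N) K) =
      MvPolynomial.C ((-1 : K) ^ N) *
        (cycW (-(1 + X) : (MvPolynomial ι K)[X]) (M.map Polynomial.C)).coeff 1 := by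
  unfold cdetPoly cycW
  simp only [map_sum, map_mul, MvPolynomial.aeval_C, map_prod, MvPolynomial.aeval_X,
    MvPolynomial.algebraMap_eq, Polynomial.finsetSum_coeff]
  rw [Finset.mul_sum]
  refine Fintype.sum_equiv ((e.symm.permCongr).trans (Equiv.inv (Perm W))) _ _ fun τ => ?_
  simp only [Equiv.trans_apply, Equiv.inv_apply]
  rw [numCycles_inv, numCycles_permCongr]
  have hprod : ∏ i, M (e.symm (τ i)) (e.symm i) = ∏ w, M w ((e.symm.permCongr τ)⁻¹ w) := by
    rw [← Fintype.prod_equiv (e.symm.permCongr τ) (fun v => M ((e.symm.permCongr τ) v) v)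
      (fun w => M w ((e.symm.permCongr τ)⁻¹ w))
      (fun v => by rw [Equiv.Perm.inv_def, Equiv.symm_apply_apply])]
    exact Fintype.prod_equiv e.symm _ _ (fun i => by simp [Equiv.permCongr_apply])
  have hterm : ((-(1 + X : (MvPolynomial ι K)[X])) ^ τ.numCycles *
      ∏ i, (M.map Polynomial.C) i (((e.symm.permCongr τ)⁻¹) i)).coeff 1 =
      ((-1) ^ τ.numCycles * (τ.numCycles : MvPolynomial ι K)) *
        ∏ w, M w ((e.symm.permCongr τ)⁻¹ w) := by
    simp only [Matrix.map_apply]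
    rw [← map_prod Polynomial.C, Polynomial.coeff_mul_C]
    have hneg : (-(1 + X) : (MvPolynomial ι K)[X]) ^ τ.numCycles =
        Polynomial.C ((-1 : MvPolynomial ι K) ^ τ.numCycles) * (1 + X) ^ τ.numCycles := by
      rw [neg_pow (1 + X : (MvPolynomial ι K)[X]), map_pow, map_neg, map_one]
    rw [hneg, Polynomial.coeff_C_mul, Polynomial.coeff_one_add_X_pow, Nat.choose_one_right]
  rw [hprod, hterm, ← mul_assoc]
  congr 1
  have hC : ((-1 : MvPolynomial ι K) ^ τ.numCycles * (τ.numCycles : MvPolynomial ι K)) =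
      MvPolynomial.C ((-1) ^ τ.numCycles * (τ.numCycles : K)) := by
    simp
  rw [hC, ← map_mul, sign_mul_numCycles_eq]

end Jets

/-! ### The cycle generating polynomial of the symmetric group: `∑_γ β^{c(γ)} = β (β+1) ⋯ (β+m-1)` -/

section CycW

variable {R : Type*} [CommRing R] {V : Type*} [Fintype V] [DecidableEq V]

/-- Row expansion of the cycle-weighted cover sum along row `a`: summing, against the entries of
row `a`, the cover sums with row `a` forced onto each column recovers `cycW`. [folklore] -/
theorem sum_mul_cycW_updateRow (b : R) (M : Matrix V V R) (a : V) :
    ∑ c, M a c * cycW b (M.updateRow a (Pi.single c 1)) = cycW b M := by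
  unfold cycW
  simp_rw [Finset.mul_sum]
  rw [Finset.sum_comm]
  refine Finset.sum_congr rfl fun σ _ => ?_
  rw [Finset.sum_eq_single (σ a)]
  · rw [← Finset.mul_prod_erase _ _ (Finset.mem_univ a), ← Finset.mul_prod_erase univ
      (fun i => M i (σ i)) (Finset.mem_univ a)]
    rw [Matrix.updateRow_self, Pi.single_eq_same]
    have h : ∏ x ∈ univ.erase a, (M.updateRow a (Pi.single (σ a) (1 : R))) x (σ x) =
        ∏ x ∈ univ.erase a, M x (σ x) :=
      Finset.prod_congr rfl fun x hx => by rw [Matrix.updateRow_ne (Finset.ne_of_mem_erase hx)]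
    rw [h]
    ring
  · intro c _ hc
    rw [← Finset.mul_prod_erase _ _ (Finset.mem_univ a), Matrix.updateRow_self,
      Pi.single_eq_of_ne (Ne.symm hc)]
    ring
  · intro h; exact absurd (Finset.mem_univ _) h

/-- Adding one vertex to the complete digraph with unit weights multiplies the cycle generating
polynomial by `β + #V` (the new vertex is a loop, weight `β`, or is inserted into one of the `#V`
arcs of a cover of the rest). [folklore] -/
theorem cycW_allOnes_option (b : R) :
    cycW b (fun _ _ : Option V => (1 : R)) = (b + Fintype.card V) * cycW b (fun _ _ : V => (1 : R)) := by
  have h : (fun _ _ : Option V => (1 : R)) = att1 (fun _ _ : V => (1 : R)) (fun _ => 1) (fun _ => 1) 1 := by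
    ext (_ | i) (_ | j) <;> rfl
  rw [h, cycW_att1]
  have hrow : ∀ a : V, ∑ c : V, (1 : R) * 1 * cycW b (Matrix.updateRow (fun _ _ : V => (1 : R)) a
      (Pi.single c 1)) = cycW b (fun _ _ : V => (1 : R)) := fun a => by
    have := sum_mul_cycW_updateRow b (fun _ _ : V => (1 : R)) a
    simpa using this
  simp_rw [hrow]
  rw [Finset.sum_const, Finset.card_univ, nsmul_eq_mul]
  ring

/-- **The cycle generating polynomial of `S_m`**: `∑_{γ ∈ S_m} β^{c(γ)} = ∏_{i<m} (β + i)` (the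
ascending Pochhammer symbol; Stirling numbers of the first kind). [folklore] -/
theorem cycW_allOnes_fin (b : R) : ∀ m : ℕ,
    cycW b (fun _ _ : Fin m => (1 : R)) = ∏ i ∈ Finset.range m, (b + i)
  | 0 => by
    unfold cycW
    rw [Finset.prod_range_zero, Fintype.sum_subsingleton _ 1]
    have : (1 : Perm (Fin 0)).numCycles = 0 :=
      Nat.eq_zero_of_le_zero
        ((Equiv.Perm.numCycles_le_card (1 : Perm (Fin 0))).trans (Fintype.card_fin 0).le)
    simp [this]
  | m + 1 => by
    have h : (fun _ _ : Fin (m + 1) => (1 : R)) =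
        Matrix.submatrix (fun _ _ : Option (Fin m) => (1 : R)) ⇑(finSuccEquiv m) ⇑(finSuccEquiv m) := rfl
    rw [h, cycW_submatrix, cycW_allOnes_option, cycW_allOnes_fin b m, Fintype.card_fin,
      Finset.prod_range_succ, mul_comm]

/-- The *return permutation* of the base averaging graph attached to `γ ∈ S_m` is
`ρ_γ = sumComm ≫ (γ ⊕ 1)`: it sends `inl i` to `inr i`. [folklore] -/
theorem retPerm_inl {m : ℕ} (γ : Perm (Fin m)) (i : Fin m) :
    ((Equiv.sumComm (Fin m) (Fin m)).trans (Equiv.sumCongr γ (Equiv.refl (Fin m)))) (Sum.inl i) =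
      Sum.inr i := rfl

/-- The return permutation sends `inr j` to `inl (γ j)`. [folklore] -/
theorem retPerm_inr {m : ℕ} (γ : Perm (Fin m)) (j : Fin m) :
    ((Equiv.sumComm (Fin m) (Fin m)).trans (Equiv.sumCongr γ (Equiv.refl (Fin m)))) (Sum.inr j) =
      Sum.inl (γ j) := rfl

/-- The return permutation has as many cycles as `γ` (each of its cycles alternates sides and its
trace on the `inr` side is a cycle of `γ`). [folklore] -/
theorem numCycles_retPerm {m : ℕ} (γ : Perm (Fin m)) :
    Equiv.Perm.numCycles ((Equiv.sumComm (Fin m) (Fin m)).trans (Equiv.sumCongr γ (Equiv.refl (Fin m)))) =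
      γ.numCycles := by
  rw [numCycles_eq_numOrbits, numCycles_eq_numOrbits]
  apply le_antisymm
  · refine numOrbits_le_of_map (f := γ)
      (g := (Equiv.sumComm (Fin m) (Fin m)).trans (Equiv.sumCongr γ (Equiv.refl (Fin m)))) Sum.inr
      (fun z => ?_) (fun x => ?_)
    · refine ⟨2, ?_⟩
      rw [show ((2 : ℤ)) = ((2 : ℕ) : ℤ) from rfl, zpow_natCast, pow_two, Perm.mul_apply,
        retPerm_inr, retPerm_inl]
    · rcases x with i | j
      · exact ⟨i, ⟨1, by simp⟩⟩
      · exact ⟨j, SameCycle.rfl⟩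
  · refine numOrbits_le_of_map
      (f := (Equiv.sumComm (Fin m) (Fin m)).trans (Equiv.sumCongr γ (Equiv.refl (Fin m)))) (g := γ)
      (Sum.elim id γ) (fun z => ?_) (fun x => ?_)
    · rcases z with i | j
      · simp only [retPerm_inl, Sum.elim_inl, Sum.elim_inr, id]
        exact ⟨1, by simp⟩
      · simp only [retPerm_inr, Sum.elim_inl, Sum.elim_inr, id]
        exact SameCycle.rfl
    · exact ⟨Sum.inl x, SameCycle.rfl⟩

/-- The weight of a return permutation in the base averaging graph is `1`. [folklore] -/
theorem prod_baseB_retPerm {m : ℕ} (γ : Perm (Fin m)) :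
    ∏ x, baseB (R := R) (n := m) (fun r => some r) x
      (((Equiv.sumComm (Fin m) (Fin m)).trans (Equiv.sumCongr γ (Equiv.refl (Fin m)))) x) = 1 := by
  rw [Fintype.prod_sum_type]
  simp [baseB]

/-- The base averaging constant is the cycle generating polynomial of `S_m`:
`K_m(β) = cycW β (all-ones m × m)`; the covers of the base averaging graph are exactly the return
permutations. [folklore] -/
theorem avgConst_eq_cycW_allOnes (m : ℕ) (b : R) :
    avgConst R m b = cycW b (fun _ _ : Fin m => (1 : R)) := by
  unfold avgConst cycW
  symm
  -- the return permutation `ρ_γ : inl i ↦ inr i, inr j ↦ inl (γ j)`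
  let ρ : Perm (Fin m) → Perm (Fin m ⊕ Fin m) := fun γ =>
    (Equiv.sumComm (Fin m) (Fin m)).trans (Equiv.sumCongr γ (Equiv.refl (Fin m)))
  have hval : ∀ γ : Perm (Fin m), b ^ γ.numCycles * ∏ i, (fun _ _ : Fin m => (1 : R)) i (γ i) =
      b ^ (ρ γ).numCycles * ∏ x, baseB (R := R) (n := m) (fun r => some r) x (ρ γ x) :=
    fun γ => by simp only [ρ]; rw [numCycles_retPerm, prod_baseB_retPerm]; simp
  refine Finset.sum_bij_ne_zero (fun γ _ _ => ρ γ) (fun _ _ _ => Finset.mem_univ _)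
    (fun γ₁ _ _ γ₂ _ _ h => ?_) ?_ (fun γ _ _ => hval γ)
  · refine Equiv.ext fun j => ?_
    have := congrArg (fun π : Perm (Fin m ⊕ Fin m) => π (Sum.inr j)) h
    simpa [ρ] using this
  · intro σ _ hσ
    have hne : ∀ x, baseB (R := R) (n := m) (fun r => some r) x (σ x) ≠ 0 := fun x hx =>
      hσ (by rw [Finset.prod_eq_zero (Finset.mem_univ x) hx, mul_zero])
    have hinl : ∀ i, σ (Sum.inl i) = Sum.inr i := fun i => by
      have h := hne (Sum.inl i)
      generalize hw : σ (Sum.inl i) = w at h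
      rcases w with j | j
      · exact absurd rfl h
      · have hij : some i = some j := by
          by_contra hij
          apply h
          simp only [baseB]
          rw [if_neg hij]
        rw [Option.some_injective _ hij]
    have hinr : ∀ j, ∃ i, σ (Sum.inr j) = Sum.inl i := fun j => by
      have h := hne (Sum.inr j)
      generalize hw : σ (Sum.inr j) = w at h
      rcases w with i | i
      · exact ⟨i, rfl⟩
      · exact absurd rfl h
    choose g hg using hinr
    have hginj : Function.Injective g := fun j j' h => by
      have : σ (Sum.inr j) = σ (Sum.inr j') := by rw [hg, hg, h]
      simpa using σ.injective this
    let γ : Perm (Fin m) := Equiv.ofBijective g (Finite.injective_iff_bijective.1 hginj)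
    have hρ : ρ γ = σ := by
      refine Equiv.ext fun x => ?_
      rcases x with i | j
      · simp only [ρ]; rw [retPerm_inl, hinl]
      · simp only [ρ]; rw [retPerm_inr, hg]; rfl
    refine ⟨γ, Finset.mem_univ _, ?_, hρ⟩
    rw [hval γ, hρ]
    exact hσ

/-- **Closed form of the averaging constant**: `K_m(β) = ∏_{i<m} (β + i)`. [folklore] -/
theorem avgConst_eq_prod (m : ℕ) (b : R) : avgConst R m b = ∏ i ∈ Finset.range m, (b + i) := by
  rw [avgConst_eq_cycW_allOnes, cycW_allOnes_fin]

end CycW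

/-! ### The averaging graph over a polynomial ring and the first Taylor coefficient -/

section Averaging

variable {R : Type*} [CommRing R] {S : Type*} [CommRing S]

/-- `att1` commutes with ring homomorphisms (as `FermionicJetJetChain.att1_map`). [folklore] -/
theorem att1_map {V : Type*} (f : R →+* S) (N : Matrix V V R) (col row : V → R) (d : R) :
    (att1 N col row d).map f = att1 (N.map f) (f ∘ col) (f ∘ row) (f d) := by
  ext (_ | i) (_ | j) <;> rfl

/-- The averaging matrices do not depend on their book-keeping weight argument and commute with
ring homomorphisms. [folklore] -/
theorem MB_map {n : ℕ} [NeZero n] (f : R →+* S) (b : R) (b' : S) (Xm : Matrix (Fin n) (Fin n) R) :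
    ∀ (k : ℕ) (c : Fin n → Option (Fin n)), (MB b Xm k c).map f = MB b' (Xm.map f) k c
  | 0, c => by
    show (baseB (R := R) c).map f = baseB c
    exact baseB_map f c
  | k + 1, c => by
    show (att1 (MB b Xm k c)
        (Pi.single (ιB n k (Sum.inl (rowOf n k)))
          (if c (rowOf n k) = none then Xm (rowOf n k) (colOf n k) else 0))
        (Pi.single (ιB n k (Sum.inr (colOf n k))) 1) 1).map f =
      att1 (MB b' (Xm.map f) k c)
        (Pi.single (ιB n k (Sum.inl (rowOf n k)))
          (if c (rowOf n k) = none then (Xm.map f) (rowOf n k) (colOf n k) else 0))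
        (Pi.single (ιB n k (Sum.inr (colOf n k))) 1) 1
    rw [att1_map, MB_map f b b' Xm k c]
    congr 1
    · funext a
      simp only [Function.comp_apply, Pi.single_apply, Matrix.map_apply]
      split_ifs <;> simp
    · funext a
      simp only [Function.comp_apply, Pi.single_apply]
      split_ifs <;> simp
    · exact map_one f

/-- Ring homomorphisms commute with the permanent. [folklore] -/
theorem permanent_map' {ι : Type*} [Fintype ι] [DecidableEq ι] (f : R →+* S) (M : Matrix ι ι R) :
    (M.map f).permanent = f M.permanent := by
  unfold Matrix.permanent
  simp [map_sum, map_prod]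

/-- The scalar of the reduction (before the sign `(-1)^N`), `q_n = (n-1)!` for `n ≥ 1` and `q_0 = -1`, is
nonzero. [folklore] -/
theorem qScalar_ne_zero (n : ℕ) : (if n = 0 then (-1 : ℤ) else ((n - 1).factorial : ℤ)) ≠ 0 := by
  split_ifs
  · norm_num
  · exact_mod_cast Nat.factorial_ne_zero _

/-- **The first Taylor coefficient at the free-fermion point.** With `β = -(1+X)` the `λ`-dependence
of the averaging graph of an `(n+1) × (n+1)` matrix is `(β^n)^{n+1} · ∏_{i ≤ n} (β + i)`; its
`X¹`-coefficient is `qz n` (`= (n-1)!` for `n ≥ 1`, `-1` for `n = 0`): the falling factorial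
`λ(λ-1)⋯(λ-n)` has a simple zero at `λ = 1`. [folklore] -/
theorem coeff_one_avgPoly (n : ℕ) :
    ((((-(1 + X) : R[X])) ^ n * 1) ^ (n + 1) *
        ∏ i ∈ Finset.range (n + 1), ((-(1 + X) : R[X]) + (i : R[X]))).coeff 1 =
      (((if n = 0 then (-1 : ℤ) else ((n - 1).factorial : ℤ)) : ℤ) : R) := by
  cases n with
  | zero =>
    simp [Polynomial.coeff_one]
  | succ k =>
    rw [Finset.prod_range_succ', Finset.prod_range_succ']
    have hsplit : (((-(1 + X) : R[X])) ^ (k + 1) * 1) ^ (k + 1 + 1) *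
        ((∏ i ∈ Finset.range k, ((-(1 + X) : R[X]) + ((i + 1 + 1 : ℕ) : R[X]))) *
          ((-(1 + X) : R[X]) + ((0 + 1 : ℕ) : R[X])) * ((-(1 + X) : R[X]) + ((0 : ℕ) : R[X]))) =
        X * ((((-(1 + X) : R[X])) ^ (k + 1)) ^ (k + 1 + 1) *
          (∏ i ∈ Finset.range k, ((-(1 + X) : R[X]) + ((i + 1 + 1 : ℕ) : R[X]))) * (1 + X)) := by
      push_cast
      ring
    rw [hsplit, Polynomial.coeff_X_mul, Polynomial.coeff_zero_eq_eval_zero]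
    simp only [Polynomial.eval_mul, Polynomial.eval_pow, Polynomial.eval_neg, Polynomial.eval_add,
      Polynomial.eval_one, Polynomial.eval_X, Polynomial.eval_prod, Polynomial.eval_natCast, add_zero,
      mul_one]
    have hpow : ((-1 : R) ^ (k + 1)) ^ (k + 1 + 1) = 1 := by
      rw [← pow_mul]
      exact Even.neg_one_pow (by rw [show k + 1 + 1 = (k + 1) + 1 by ring]; exact Nat.even_mul_succ_self _)
    have hprod : ∏ i ∈ Finset.range k, ((-1 : R) + ((i + 1 + 1 : ℕ) : R)) = ((k.factorial : ℕ) : R) := by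
      rw [← Finset.prod_range_add_one_eq_factorial, Nat.cast_prod]
      refine Finset.prod_congr rfl fun i _ => ?_
      push_cast
      ring
    rw [hpow, hprod, if_neg (Nat.succ_ne_zero k), Nat.add_sub_cancel]
    push_cast
    ring

/-- **The reduction identity.** Substituting the averaging graph of an `(n+1) × (n+1)` matrix `Z`
(de Rugy-Altherre's Stage B graph: `inl i → p_{ij}` with weight `Z i j`, `p_{ij} → inr j`,
`inr j → inl b` for all `b`, unit loops on the pass vertices `p_{ij}`; reindexed by `Fin N`) into `cdet_N`
gives `(-1)^N · q_n · per Z`, `q_n = (n-1)!` (`-1` for `n = 0`): by `DeRugyAltherre.cycW_MB` the pencil of the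
graph is `(β^n)^{n+1} K_{n+1}(β) · per Z`, `K_{n+1}(β) = β(β+1)⋯(β+n)`, whose first Taylor coefficient at
`β = -1` is `q_n` (`coeff_one_avgPoly`). The weight argument `0` of `MB` is book-keeping only. [folklore] -/
theorem aeval_MB_cdetPoly {ι : Type*} (n : ℕ) (Z : Matrix (Fin (n + 1)) (Fin (n + 1)) (MvPolynomial ι ℂ))
    {N : ℕ} (e : WB (n + 1) ((n + 1) * (n + 1)) ≃ Fin N) :
    MvPolynomial.aeval
        (fun pq : Fin N × Fin N =>
          MB (0 : MvPolynomial ι ℂ) Z ((n + 1) * (n + 1)) (fun _ => none) (e.symm pq.1) (e.symm pq.2))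
        (cdetPoly (Fin N) ℂ) =
      MvPolynomial.C ((-1) ^ N * (((if n = 0 then (-1 : ℤ) else ((n - 1).factorial : ℤ)) : ℤ) : ℂ)) *
        Z.permanent := by
  have hc := coeff_one_avgPoly (R := MvPolynomial ι ℂ) n
  generalize (if n = 0 then (-1 : ℤ) else ((n - 1).factorial : ℤ)) = q at hc ⊢
  rw [aeval_cdetPoly_eq_coeff_cycW e,
    MB_map Polynomial.C 0 (-(1 + X)) Z, cycW_MB, avgConst_eq_prod, permanent_map', Nat.add_sub_cancel,
    ← mul_assoc, Polynomial.coeff_mul_C, hc, ← map_intCast (MvPolynomial.C (σ := ι) (R := ℂ)) q,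
    map_mul, mul_assoc]

end Averaging


end FermionicJetHcProjectsToCdet

end Summit.ValiantsHypothesis.ValiantsHypothesis.Theorems
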